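import Mathlib
import Summits.Ventures.PercRepro2.SkeletonPath
import Summits.Ventures.PercRepro2.HMFPendantRoot
import Summits.Ventures.PercRepro2.HMFPendantO
import Summits.Ventures.PercRepro2.HMFPendantB
import Summits.Ventures.PercRepro2.HMFPendantBAtt
import Summits.Ventures.PercRepro2.HCovSwap

/-!
# The pendant map modulo reduction: `a₃` pendant at a mark through a path (blind cell PercRepro2,
night-1 g16; NIGHT1-G16.md §4′)

The four pendant classes of the cell's map — `a₃` a leaf at the root `a₂` (`HMF_pendant_root`), at
`o` (`HMF_pendant_o`), at `b` (`HMF_pendant_b` + `attB_nonneg`), at the root `a₁` ((HCOV) by the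
root symmetry `HCov_swap`) — transported along the reduction relation: **`HMF_of_reduces_leaf_at_*`**
(the class on the nonzero edges of any reduct) and **`HMF_pendant_path_*`** (`a₃` joined to the mark
by a path of nonzero edges through unmarked vertices of nonzero-degree two, `Skeleton.IsPath`, with
no other nonzero edge at `a₃`): the subdivided pendant map.

Own code; standard axioms.
-/

open scoped Classical

namespace Summit.Ventures.PercRepro2

open UnionCluster CovForm

namespace Skeleton

section LeafAtMark

variable {V : Type*} {E : Type*} [Fintype E] [DecidableEq E] [Fintype V] [DecidableEq V]
  {R : Type*} [Field R] [LinearOrder R] [IsStrictOrderedRing R]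

variable {o a₁ a₂ a₃ b : V}

omit [Fintype E] [DecidableEq E] [Fintype V] [DecidableEq V] [IsStrictOrderedRing R] in
/-- After re-routing the zero-weight edges to loops at `a₁ ≠ a₃`, a nonzero leaf edge `f = {a₃, y}`
(the only nonzero edge at `a₃`) is the only edge at `a₃`. -/
lemma leaf_reroute (q : E → R) (ends' : E → Sym2 V) {f : E} {y : V} (hf : ends' f = s(a₃, y))
    (hqf : q f ≠ 0) (hleaf : ∀ e, q e ≠ 0 → a₃ ∈ ends' e → e = f) (h31 : a₃ ≠ a₁) :
    reroute q ends' a₁ f = s(a₃, y) ∧ ∀ e, a₃ ∈ reroute q ends' a₁ e → e = f := by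
  refine ⟨by rw [reroute_of_ne q ends' a₁ hqf, hf], ?_⟩
  intro e he
  have hqe : q e ≠ 0 := ne_zero_of_mem_reroute q ends' h31 he
  rw [reroute_of_ne q ends' a₁ hqe] at he
  exact hleaf e hqe he

/-- **`a₃` pendant at the root `a₂` modulo reduction** (HMF). -/
theorem HMF_of_reduces_leaf_at_root2 {p : E → R} {ends : E → Sym2 V} (hp : IsProbVec p)
    {q : E → R} {ends' : E → Sym2 V} (h : Reduces o a₁ a₂ a₃ b (p, ends) (q, ends'))
    {f : E} (hf : ends' f = s(a₃, a₂)) (hqf : q f ≠ 0)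
    (hleaf : ∀ e, q e ≠ 0 → a₃ ∈ ends' e → e = f)
    (h32 : a₃ ≠ a₂) (h31 : a₃ ≠ a₁) (ho : o ≠ a₃) (hb : b ≠ a₃) :
    HMF p ends o a₁ a₂ a₃ b := by
  obtain ⟨hf'', hleaf''⟩ := leaf_reroute (a₁ := a₁) q ends' hf hqf hleaf h31
  have h' : Reduces o a₁ a₂ a₃ b (p, ends) (q, reroute q ends' a₁) :=
    Relation.ReflTransGen.tail h (Step.reroute fun _ he => (reroute_of_ne q ends' a₁ he).symm)
  exact HMF_of_reduces (I := (p, ends)) h' hp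
    (HMFPendantRoot.HMF_pendant_root q _ (isProbVec_of_reduces (I := (p, ends)) h hp) hf'' hleaf''
      h32 h31 ho hb)

/-- **`a₃` pendant at `o` modulo reduction** (HMF). -/
theorem HMF_of_reduces_leaf_at_o {p : E → R} {ends : E → Sym2 V} (hp : IsProbVec p)
    {q : E → R} {ends' : E → Sym2 V} (h : Reduces o a₁ a₂ a₃ b (p, ends) (q, ends'))
    {f : E} (hf : ends' f = s(a₃, o)) (hqf : q f ≠ 0)
    (hleaf : ∀ e, q e ≠ 0 → a₃ ∈ ends' e → e = f)
    (h3o : a₃ ≠ o) (h31 : a₃ ≠ a₁) (h32 : a₃ ≠ a₂) (hb : b ≠ a₃) :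
    HMF p ends o a₁ a₂ a₃ b := by
  obtain ⟨hf'', hleaf''⟩ := leaf_reroute (a₁ := a₁) q ends' hf hqf hleaf h31
  have h' : Reduces o a₁ a₂ a₃ b (p, ends) (q, reroute q ends' a₁) :=
    Relation.ReflTransGen.tail h (Step.reroute fun _ he => (reroute_of_ne q ends' a₁ he).symm)
  exact HMF_of_reduces (I := (p, ends)) h' hp
    (HMFPendantO.HMF_pendant_o q _ (isProbVec_of_reduces (I := (p, ends)) h hp) hf'' hleaf''
      h3o h31 h32 hb)

/-- **`a₃` pendant at `b` modulo reduction** (HMF). -/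
theorem HMF_of_reduces_leaf_at_b {p : E → R} {ends : E → Sym2 V} (hp : IsProbVec p)
    {q : E → R} {ends' : E → Sym2 V} (h : Reduces o a₁ a₂ a₃ b (p, ends) (q, ends'))
    {f : E} (hf : ends' f = s(a₃, b)) (hqf : q f ≠ 0)
    (hleaf : ∀ e, q e ≠ 0 → a₃ ∈ ends' e → e = f)
    (h3b : a₃ ≠ b) (h31 : a₃ ≠ a₁) (h32 : a₃ ≠ a₂) (ho : o ≠ a₃) :
    HMF p ends o a₁ a₂ a₃ b := by
  obtain ⟨hf'', hleaf''⟩ := leaf_reroute (a₁ := a₁) q ends' hf hqf hleaf h31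
  have h' : Reduces o a₁ a₂ a₃ b (p, ends) (q, reroute q ends' a₁) :=
    Relation.ReflTransGen.tail h (Step.reroute fun _ he => (reroute_of_ne q ends' a₁ he).symm)
  have hq : IsProbVec q := isProbVec_of_reduces (I := (p, ends)) h hp
  exact HMF_of_reduces (I := (p, ends)) h' hp
    (HMFPendantB.HMF_pendant_b q _ hq hf'' hleaf'' h3b h31 h32 ho
      (HMFPendantB.attB_nonneg q _ hq o a₁ a₂ b))

/-- **`a₃` pendant at the root `a₁` modulo reduction** ((HCOV), by the root symmetry). -/
theorem HCov_of_reduces_leaf_at_root1 {p : E → R} {ends : E → Sym2 V} (hp : IsProbVec p)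
    {q : E → R} {ends' : E → Sym2 V} (h : Reduces o a₁ a₂ a₃ b (p, ends) (q, ends'))
    {f : E} (hf : ends' f = s(a₃, a₁)) (hqf : q f ≠ 0)
    (hleaf : ∀ e, q e ≠ 0 → a₃ ∈ ends' e → e = f)
    (h31 : a₃ ≠ a₁) (h32 : a₃ ≠ a₂) (ho : o ≠ a₃) (hb : b ≠ a₃) :
    HCov p ends o a₁ a₂ a₃ b := by
  -- re-route to loops at `a₂ ≠ a₃` this time
  have hf'' : reroute q ends' a₂ f = s(a₃, a₁) := by rw [reroute_of_ne q ends' a₂ hqf, hf]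
  have hleaf'' : ∀ e, a₃ ∈ reroute q ends' a₂ e → e = f := by
    intro e he
    have hqe : q e ≠ 0 := ne_zero_of_mem_reroute q ends' h32 he
    rw [reroute_of_ne q ends' a₂ hqe] at he
    exact hleaf e hqe he
  have h' : Reduces o a₁ a₂ a₃ b (p, ends) (q, reroute q ends' a₂) :=
    Relation.ReflTransGen.tail h (Step.reroute fun _ he => (reroute_of_ne q ends' a₂ he).symm)
  have hq : IsProbVec q := isProbVec_of_reduces (I := (p, ends)) h hp
  refine HCov_of_reduces (I := (p, ends)) h' hp ?_
  rw [← HCov_swap]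
  exact HCov_of_HMF q hq _ o a₂ a₁ a₃ b
    (HMFPendantRoot.HMF_pendant_root q _ hq hf'' hleaf'' h31 h32 ho hb)

end LeafAtMark

section PathToMark

variable {V : Type*} {E : Type*} [Fintype E] [DecidableEq E] [Fintype V] [DecidableEq V]
  {R : Type*} [Field R] [LinearOrder R] [IsStrictOrderedRing R]

variable {o a₁ a₂ a₃ b : V}

omit [Fintype E] [Fintype V] [DecidableEq V] [LinearOrder R] [IsStrictOrderedRing R] in
/-- The contracted weight of the first path edge is the product of the path weights. -/
lemma pathWeight_es0 (p : E → R) (es : ℕ → E) (k : ℕ) :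
    pathWeight p es k (es 0) = ∏ i ∈ Finset.range k, p (es i) := by
  unfold pathWeight; simp

omit [Fintype E] [Fintype V] [DecidableEq V] [LinearOrder R] [IsStrictOrderedRing R] in
/-- An edge of nonzero contracted weight other than the first path edge has nonzero weight. -/
lemma ne_zero_of_pathWeight_ne_zero (p : E → R) (es : ℕ → E) (k : ℕ) {e : E} (he0 : e ≠ es 0)
    (he : pathWeight p es k e ≠ 0) : p e ≠ 0 := by
  unfold pathWeight at he
  rw [if_neg he0] at he
  by_cases hex : ∃ i, 0 < i ∧ i < k ∧ e = es i
  · rw [if_pos hex] at he; exact absurd rfl he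
  · rw [if_neg hex] at he; exact he

omit [Fintype E] [Fintype V] [DecidableEq V] [LinearOrder R] [IsStrictOrderedRing R] in
/-- In the contracted instance the first path edge is the only nonzero edge at `a₃ = vs 0`. -/
lemma path_leaf (p : E → R) (ends : E → Sym2 V) (k : ℕ) (vs : ℕ → V) (es : ℕ → E)
    (h : IsPath p ends o a₁ a₂ a₃ b k vs es)
    (hleaf : ∀ e, p e ≠ 0 → a₃ ∈ ends e → e = es 0) :
    pathWeight p es k (es 0) ≠ 0 ∧
      ∀ e, pathWeight p es k e ≠ 0 → a₃ ∈ Function.update ends (es 0) s(vs 0, vs k) e → e = es 0 := by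
  refine ⟨?_, ?_⟩
  · rw [pathWeight_es0]
    exact Finset.prod_ne_zero_iff.2 fun i hi => h.nz i (Finset.mem_range.1 hi)
  · intro e he hae
    by_contra hne
    have hpe := ne_zero_of_pathWeight_ne_zero p es k hne he
    rw [Function.update_of_ne hne] at hae
    exact hne (hleaf e hpe hae)

/-- **The subdivided pendant map at `a₂`**: `a₃` joined to the root `a₂` by a path of nonzero edges
through unmarked vertices of nonzero-degree two, no other nonzero edge at `a₃` ⊢ (HMF). -/
theorem HMF_pendant_path_root2 (p : E → R) (ends : E → Sym2 V) (hp : IsProbVec p) (k : ℕ)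
    (vs : ℕ → V) (es : ℕ → E) (h : IsPath p ends o a₁ a₂ a₃ b k vs es) (h0 : vs 0 = a₃)
    (hk : vs k = a₂) (hleaf : ∀ e, p e ≠ 0 → a₃ ∈ ends e → e = es 0)
    (h32 : a₃ ≠ a₂) (h31 : a₃ ≠ a₁) (ho : o ≠ a₃) (hb : b ≠ a₃) :
    HMF p ends o a₁ a₂ a₃ b := by
  obtain ⟨hnz, hl⟩ := path_leaf p ends k vs es h hleaf
  have hf : Function.update ends (es 0) s(vs 0, vs k) (es 0) = s(a₃, a₂) := by
    rw [Function.update_self, h0, hk]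
  exact HMF_of_reduces_leaf_at_root2 hp (reduces_of_isPath p ends hp k vs es h) hf hnz hl h32 h31
    ho hb

/-- **The subdivided pendant map at `o`.** -/
theorem HMF_pendant_path_o (p : E → R) (ends : E → Sym2 V) (hp : IsProbVec p) (k : ℕ)
    (vs : ℕ → V) (es : ℕ → E) (h : IsPath p ends o a₁ a₂ a₃ b k vs es) (h0 : vs 0 = a₃)
    (hk : vs k = o) (hleaf : ∀ e, p e ≠ 0 → a₃ ∈ ends e → e = es 0)
    (h3o : a₃ ≠ o) (h31 : a₃ ≠ a₁) (h32 : a₃ ≠ a₂) (hb : b ≠ a₃) :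
    HMF p ends o a₁ a₂ a₃ b := by
  obtain ⟨hnz, hl⟩ := path_leaf p ends k vs es h hleaf
  have hf : Function.update ends (es 0) s(vs 0, vs k) (es 0) = s(a₃, o) := by
    rw [Function.update_self, h0, hk]
  exact HMF_of_reduces_leaf_at_o hp (reduces_of_isPath p ends hp k vs es h) hf hnz hl h3o h31 h32 hb

/-- **The subdivided pendant map at `b`.** -/
theorem HMF_pendant_path_b (p : E → R) (ends : E → Sym2 V) (hp : IsProbVec p) (k : ℕ)
    (vs : ℕ → V) (es : ℕ → E) (h : IsPath p ends o a₁ a₂ a₃ b k vs es) (h0 : vs 0 = a₃)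
    (hk : vs k = b) (hleaf : ∀ e, p e ≠ 0 → a₃ ∈ ends e → e = es 0)
    (h3b : a₃ ≠ b) (h31 : a₃ ≠ a₁) (h32 : a₃ ≠ a₂) (ho : o ≠ a₃) :
    HMF p ends o a₁ a₂ a₃ b := by
  obtain ⟨hnz, hl⟩ := path_leaf p ends k vs es h hleaf
  have hf : Function.update ends (es 0) s(vs 0, vs k) (es 0) = s(a₃, b) := by
    rw [Function.update_self, h0, hk]
  exact HMF_of_reduces_leaf_at_b hp (reduces_of_isPath p ends hp k vs es h) hf hnz hl h3b h31 h32 ho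

/-- **The subdivided pendant map at `a₁`** ((HCOV)). -/
theorem HCov_pendant_path_root1 (p : E → R) (ends : E → Sym2 V) (hp : IsProbVec p) (k : ℕ)
    (vs : ℕ → V) (es : ℕ → E) (h : IsPath p ends o a₁ a₂ a₃ b k vs es) (h0 : vs 0 = a₃)
    (hk : vs k = a₁) (hleaf : ∀ e, p e ≠ 0 → a₃ ∈ ends e → e = es 0)
    (h31 : a₃ ≠ a₁) (h32 : a₃ ≠ a₂) (ho : o ≠ a₃) (hb : b ≠ a₃) :
    HCov p ends o a₁ a₂ a₃ b := by
  obtain ⟨hnz, hl⟩ := path_leaf p ends k vs es h hleaf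
  have hf : Function.update ends (es 0) s(vs 0, vs k) (es 0) = s(a₃, a₁) := by
    rw [Function.update_self, h0, hk]
  exact HCov_of_reduces_leaf_at_root1 hp (reduces_of_isPath p ends hp k vs es h) hf hnz hl h31 h32
    ho hb

end PathToMark

end Skeleton

end Summit.Ventures.PercRepro2
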